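import Mathlib.Topology.Homeomorph.Lemmas
import Literature.AlgebraicGeometry.Frobenioids.BaseFrobeniusSections
import Literature.AlgebraicGeometry.Frobenioids.ProfiniteUnitsProofs
import Literature.AlgebraicGeometry.Frobenioids.PadicUnitGroupProfinite
import HarnessLib

/-!
# Frobenioids I, Def. 2.8 (i) "(uniquely determined)" AT ITS PRINTED SUBJECT: the unit groups `O^×(A)` of a
# Frobenioid, and [FrdII] Thm. 1.2 (i) for the `p`-adic Frobenioid (PROOFS)

Mochizuki, *The geometry of Frobenioids I: the general theory*, Kyushu J. Math. **62** (2008) 293–400,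
Definition 2.8 (i), Kyushu p. 338 (= kurims p. 52) [cite: MochizukiFrdI2008, Def. 2.8(i) p.52], verbatim:
"(i) If, for every `A ∈ Ob(C)`, it holds that `O^×(A)` admits a (uniquely determined) profinite topology such
that `O^×(A)`, equipped with this topology, is a topologically finitely generated profinite (abelian) group,
then we shall say that `C` is of unit-profinite type."  Here `C` is a Frobenioid (standing assumption of §2)
and `O^×(A)` is abelian by Remark 1.3.1 (tree: `PreFrobenioid.unitsSubgroup_comm`).

The tree records the parenthetical "(uniquely determined)" as the named statement
`TfgProfiniteTopologyUnique M` (`ProfiniteUnits.lean`: two topologically finitely generated profinite group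
topologies on the group `M` coincide; cell abc-iut FACT-LIST row F-1275) and proves it for ABELIAN `M`
(`TfgProfiniteTopologyUnique.of_commGroup`, `ProfiniteUnitsProofs.lean`); over an arbitrary group it is the
Nikolov–Segal theorem (tree: conditional closer `TfgProfiniteTopologyUnique.of_nikolovSegalStatement`).
This PROOF-ONLY companion (no definitions, no statement edited) closes the parenthetical at the ONLY objects
the text applies it to:

* `TfgProfiniteTopologyUnique.of_mulEquiv` — the statement is invariant under group isomorphisms `M ≃* N`
  in ARBITRARY universes (transport of topologies along `≃*`; `IsTfgProfinite.induced_symm_mulEquiv` is the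
  one-topology push-forward lemma; the same-universe pull-back form is abc-iut-L1-d6's
  `IsTfgProfinite.induced_mulEquiv`, `ProfiniteUnitsTopologyUniqueStrength.lean`, whose `∀`-level
  strength statements this file complements at the level of the printed INSTANCES);
* `PreFrobenioid.tfgProfiniteTopologyUnique_unitsSubgroup` — for EVERY Frobenioid and EVERY object `A`, two
  topologically finitely generated profinite group topologies on `O^×(A)` coincide (no further hypothesis);
  hence `PreFrobenioid.existsUnique_isTfgProfinite_unitsSubgroup` /
  `PreFrobenioid.isOfUnitProfiniteType_iff_existsUnique`: "of unit-profinite type" (Def. 2.8 (i) as typed,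
  existence only) is EQUIVALENT to the printed sentence with its parenthetical, "admits a uniquely
  determined … topology" (`∃!`);
* `PadicFrd.Datum.tfgProfiniteTopologyUnique_unitsSubgroup` / `…existsUnique_isTfgProfinite_unitsSubgroup` —
  the same for the `p`-adic Frobenioid of [FrdII] Ex. 1.1 / Thm. 1.2 (i)
  [cite: MochizukiFrdII2008, Thm 1.2 (i) p.9] ("(i) If `Λ = ℤ` …, then `C` is of unit-profinite … type",
  Kyushu p. 407 = kurims p. 9; the tree's `p`-adic Frobenioid datum is the `Λ = ℤ` case), for EVERY
  datum `d` (no monoid-data hypothesis: `O^×(A) ≅ O_{K_A}^×` is abelian), combining the landed existence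
  theorem `PadicFrd.Datum.thm12_i_unitProfinite` with uniqueness.

HONEST FRAMING: refereed pre-IUT material; an instance-form theorem at the printed subject is not the universal
closure over all groups (that closure is Nikolov–Segal, CFSG-dependent, not proved in the tree); nothing here
bears on [IUTchIII] Cor. 3.12 or asserts anything about abc.
-/

namespace Literature.AlgebraicGeometry.Frobenioids

open CategoryTheory Opposite Topology

universe w v v' u u'

/-! ### Transport of topologically finitely generated profinite topologies along a group isomorphism -/

section Transport

variable {M : Type*} [Group M] {N : Type*} [Group N]

/-- Transport of structure (push-forward form, `M` and `N` in arbitrary universes): if `t` makes `M` a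
topologically finitely generated profinite group and `e : M ≃* N` is a group isomorphism, then the topology on
`N` induced along `e⁻¹` (for which `e` is a homeomorphism) makes `N` a topologically finitely generated
profinite group.  (Same-universe pull-back form: `IsTfgProfinite.induced_mulEquiv`,
`ProfiniteUnitsTopologyUniqueStrength.lean`.) [cite: MochizukiFrdI2008, Def. 2.8(i) p.52] -/
theorem IsTfgProfinite.induced_symm_mulEquiv (e : M ≃* N) {t : TopologicalSpace M}
    (ht : @IsTfgProfinite M _ t) :
    @IsTfgProfinite N _ (TopologicalSpace.induced (e.symm : N → M) t) := by
  letI : TopologicalSpace M := t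
  letI tN : TopologicalSpace N := TopologicalSpace.induced (e.symm : N → M) t
  have hind : IsInducing (e.symm : N → M) := ⟨rfl⟩
  haveI := ht.isTopologicalGroup
  haveI := ht.compactSpace
  haveI := ht.t2Space
  haveI := ht.totallyDisconnectedSpace
  let ψ : N ≃ₜ M := e.symm.toEquiv.toHomeomorphOfIsInducing hind
  refine ⟨?_, ?_, ?_, ?_, ?_⟩
  · exact hind.topologicalGroup (e.symm : N →* M)
  · exact ψ.symm.compactSpace
  · exact ψ.symm.t2Space
  · exact ψ.symm.totallyDisconnectedSpace
  · obtain ⟨S, hS⟩ := ht.exists_finset_dense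
    classical
    refine ⟨S.image e, ?_⟩
    have hset : ((Subgroup.closure ((S.image e : Finset N) : Set N) : Subgroup N) : Set N) =
        (e.symm : N → M) ⁻¹' ((Subgroup.closure (S : Set M) : Subgroup M) : Set M) := by
      ext x
      simp only [Finset.coe_image, SetLike.mem_coe, Set.mem_preimage]
      constructor
      · intro hx
        have h := Subgroup.mem_map_of_mem (e.symm : N →* M) hx
        rw [MonoidHom.map_closure] at h
        refine (Subgroup.closure_mono ?_) h
        rintro _ ⟨_, ⟨s, hs, rfl⟩, rfl⟩
        simpa using hs
      · intro hx
        have h := Subgroup.mem_map_of_mem (e : M →* N) hx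
        rw [MonoidHom.map_closure] at h
        simpa using h
    have hd : Dense ((ψ : N → M) ⁻¹' ((Subgroup.closure (S : Set M) : Subgroup M) : Set M)) := by
      rw [dense_iff_closure_eq, ← ψ.preimage_closure, dense_iff_closure_eq.mp hS, Set.preimage_univ]
    rw [hset]
    exact hd

/-- **Def. 2.8 (i) "(uniquely determined)" is invariant under group isomorphisms**: if two topologically
finitely generated profinite group topologies on `N` always coincide and `e : M ≃* N`, then the same holds on
`M` (push both topologies forward along `e`, compare on `N`, pull back).
[cite: MochizukiFrdI2008, Def. 2.8(i) p.52] -/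
theorem TfgProfiniteTopologyUnique.of_mulEquiv (e : M ≃* N) (h : TfgProfiniteTopologyUnique N) :
    TfgProfiniteTopologyUnique M := by
  intro t₁ t₂ h₁ h₂
  have key :=
    h _ _ (IsTfgProfinite.induced_symm_mulEquiv e h₁) (IsTfgProfinite.induced_symm_mulEquiv e h₂)
  -- pull back along `e`: `induced e (induced e.symm t) = t`
  have hback : ∀ t : TopologicalSpace M,
      TopologicalSpace.induced (e : M → N) (TopologicalSpace.induced (e.symm : N → M) t) = t := by
    intro t
    rw [induced_compose]
    have : ((e.symm : N → M) ∘ (e : M → N)) = id := by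
      funext x
      simp
    rw [this, induced_id]
  rw [← hback t₁, ← hback t₂, key]

/-- The converse transport, for convenience: uniqueness on `M` gives uniqueness on any isomorphic `N`.
[cite: MochizukiFrdI2008, Def. 2.8(i) p.52] -/
theorem TfgProfiniteTopologyUnique.mulEquiv (e : M ≃* N) (h : TfgProfiniteTopologyUnique M) :
    TfgProfiniteTopologyUnique N :=
  TfgProfiniteTopologyUnique.of_mulEquiv e.symm h

end Transport

/-! ### Def. 2.8 (i) at its printed subject: the unit groups `O^×(A)` of a Frobenioid -/

namespace PreFrobenioid

variable {D : Type u} [Category.{v} D] {Φ : Dᵒᵖ ⥤ CommMonCat.{w}}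
  {C : Type u'} [Category.{v'} C] (F : C ⥤ ElemFrobenioid Φ)

/-- **Def. 2.8 (i), "(uniquely determined)", for the `O^×(A)` of a Frobenioid — unconditionally.**  For a
Frobenioid `C` and any `A ∈ Ob(C)`, two profinite topologies on `O^×(A)` making it a topologically finitely
generated profinite group coincide: `O^×(A)` is abelian (Remark 1.3.1, `unitsSubgroup_comm`), and for abelian
groups the parenthetical is the tree's theorem `TfgProfiniteTopologyUnique.of_commGroup`.
[cite: MochizukiFrdI2008, Def. 2.8(i) p.52] -/
theorem tfgProfiniteTopologyUnique_unitsSubgroup (hF : IsFrobenioid F) (A : C) :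
    TfgProfiniteTopologyUnique (unitsSubgroup F A) :=
  @TfgProfiniteTopologyUnique.of_commGroup (unitsSubgroup F A) (unitsCommGroup F hF A)

/-- Two-topology form of the preceding: any two topologically finitely generated profinite group topologies
on the `O^×(A)` of a Frobenioid are EQUAL. [cite: MochizukiFrdI2008, Def. 2.8(i) p.52] -/
theorem IsTfgProfinite.unitsSubgroup_topology_eq (hF : IsFrobenioid F) (A : C)
    {t₁ t₂ : TopologicalSpace (unitsSubgroup F A)}
    (h₁ : @IsTfgProfinite (unitsSubgroup F A) _ t₁) (h₂ : @IsTfgProfinite (unitsSubgroup F A) _ t₂) :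
    t₁ = t₂ :=
  tfgProfiniteTopologyUnique_unitsSubgroup F hF A t₁ t₂ h₁ h₂

/-- **Def. 2.8 (i), the full printed sentence.**  If the Frobenioid `C` is of unit-profinite type (as typed:
every `O^×(A)` ADMITS a topologically finitely generated profinite topology), then every `O^×(A)` admits a
UNIQUELY DETERMINED such topology. [cite: MochizukiFrdI2008, Def. 2.8(i) p.52] -/
theorem existsUnique_isTfgProfinite_unitsSubgroup (hF : IsFrobenioid F) (hC : IsOfUnitProfiniteType F)
    (A : C) :
    ∃! t : TopologicalSpace (unitsSubgroup F A), @IsTfgProfinite (unitsSubgroup F A) _ t := by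
  obtain ⟨t, ht⟩ := hC A
  exact ⟨t, ht, fun t' ht' => tfgProfiniteTopologyUnique_unitsSubgroup F hF A t' t ht' ht⟩

/-- **Def. 2.8 (i), existence-only ⟺ existence-and-uniqueness.**  For a Frobenioid, "of unit-profinite
type" as typed (`IsOfUnitProfiniteType`: each `O^×(A)` admits SOME topologically finitely generated profinite
topology) is equivalent to the printed sentence with its parenthetical (each `O^×(A)` admits EXACTLY ONE).
[cite: MochizukiFrdI2008, Def. 2.8(i) p.52] -/
theorem isOfUnitProfiniteType_iff_existsUnique (hF : IsFrobenioid F) :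
    IsOfUnitProfiniteType F ↔
      ∀ A : C, ∃! t : TopologicalSpace (unitsSubgroup F A), @IsTfgProfinite (unitsSubgroup F A) _ t :=
  ⟨fun hC A => existsUnique_isTfgProfinite_unitsSubgroup F hF hC A, fun h A => (h A).exists⟩

/-- "The profinite topology of `O^×(A)`" (as used in Prop. 2.9 (ii) (c): "for the profinite topology of
`O^×(A)`") is well defined for a Frobenioid of unit-profinite type: a CHOSEN admissible topology equals every
admissible topology. [cite: MochizukiFrdI2008, Prop. 2.9(ii) p.53] -/
theorem isTfgProfinite_choose_eq (hF : IsFrobenioid F) (hC : IsOfUnitProfiniteType F) (A : C)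
    {t : TopologicalSpace (unitsSubgroup F A)} (ht : @IsTfgProfinite (unitsSubgroup F A) _ t) :
    (hC A).choose = t :=
  tfgProfiniteTopologyUnique_unitsSubgroup F hF A _ _ (hC A).choose_spec ht

end PreFrobenioid

/-! ### [FrdII] Thm. 1.2 (i): the `p`-adic Frobenioid is of unit-profinite type — with uniqueness -/

namespace PadicFrd

namespace Datum

variable {D : Type u} [Category.{v} D] {p : ℕ} [Fact p.Prime] (d : Datum D p)

/-- **[FrdII] Thm. 1.2 (i), "(uniquely determined)" for the `p`-adic Frobenioid — unconditionally** (every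
datum `d`, every object `X`; no monoid-data hypothesis): two topologically finitely generated profinite group
topologies on `O^×(X)` coincide, since `O^×(X) ≅ O_{K_X}^×` (`nonempty_unitsSubgroup_mulEquiv_unitSubgroup`)
is abelian. [cite: MochizukiFrdII2008, Thm 1.2 (i) p.9] -/
theorem tfgProfiniteTopologyUnique_unitsSubgroup (X : d.frobenioid) :
    TfgProfiniteTopologyUnique (PreFrobenioid.unitsSubgroup d.structureFunctor X) := by
  obtain ⟨e⟩ := d.nonempty_unitsSubgroup_mulEquiv_unitSubgroup X
  exact TfgProfiniteTopologyUnique.of_mulEquiv e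
    (TfgProfiniteTopologyUnique.of_commGroup (unitSubgroup (d.fld X.base)))

/-- **[FrdII] Thm. 1.2 (i), first sentence with [FrdI] Def. 2.8 (i)'s parenthetical: every `O^×(X)` of the
`p`-adic Frobenioid admits a UNIQUELY DETERMINED topologically finitely generated profinite topology**
(existence = the landed `thm12_i_unitProfinite`; uniqueness = the preceding theorem).
[cite: MochizukiFrdII2008, Thm 1.2 (i) p.9] -/
theorem existsUnique_isTfgProfinite_unitsSubgroup (X : d.frobenioid) :
    ∃! t : TopologicalSpace (PreFrobenioid.unitsSubgroup d.structureFunctor X),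
      @IsTfgProfinite (PreFrobenioid.unitsSubgroup d.structureFunctor X) _ t := by
  obtain ⟨t, ht⟩ := d.thm12_i_unitProfinite X
  exact ⟨t, ht, fun t' ht' => d.tfgProfiniteTopologyUnique_unitsSubgroup X t' t ht' ht⟩

/-- The unit group `O_K^×` of the field under a base object itself: two topologically finitely generated
profinite group topologies on `O_{K_A}^×` coincide, and (for `K_A` a finite extension of `ℚ_p`, as every base
object of a datum is) there is exactly one. [cite: MochizukiFrdII2008, Thm 1.2 (i) p.9] -/
theorem existsUnique_isTfgProfinite_unitSubgroup (A : D) :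
    ∃! t : TopologicalSpace (unitSubgroup (d.fld A)), @IsTfgProfinite (unitSubgroup (d.fld A)) _ t := by
  obtain ⟨t, ht⟩ := PadicFld.admitsTfgProfiniteTopology_unitSubgroup _ (d.isPadicLocal A)
  exact ⟨t, ht, fun t' ht' =>
    TfgProfiniteTopologyUnique.of_commGroup (unitSubgroup (d.fld A)) t' t ht' ht⟩

end Datum

end PadicFrd

end Literature.AlgebraicGeometry.Frobenioids
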